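import Summits.CriticalPhenomena.PercolationContinuityZ3.Theorems.Transplant.FKConnectivityAllQForestHubFour
import Summits.CriticalPhenomena.PercolationContinuityZ3.Theorems.Transplant.FKConnectivityAllQForestFourTerminalSplit
import HarnessLib

/-!
# The square-free adjacent forest Rayleigh node at a DEGREE-4 HUB is ONE 4-terminal inequality on the `o`-deleted rest

Support file (`--supports stmt-CriticalPhenomena-4575`), FK sub-lane `prim-bschramm-fk-1` (gen 24) of the post-continuity programme;
builds on p205010 (kernel theorem, internal audit signed; external expert review pending).  No definitions, no named facts, no sorries;
standard axioms.  Companion of `…ForestHubFour` (the degree-4 hub decomposition `hubFour_bad_good_eq`).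

With `N(S ‖ T) := #_{(M ∖ {oa,ob}, u₀)}(Fo ∩ {S pairwise separated}, Fo ∩ {T pairwise separated})` (first event on the configuration,
second on its partner) the decomposition reads `bad = N(vyab‖·) + N(vya‖·) + N(vyb‖·) + N(vy‖ab)`,
`good = N(vab‖·) + N(va‖yb) + N(vb‖ya) + N(·‖yab)`; the involution `ω ↦ ω ∆ M₂` (`fibreCount_swap`) gives `N(·‖yab) = N(yab‖·)`, so:
* **`adjForestNoSq_guarded_of_hubFour`**: the 4-terminal inequality
  (H4) `N(vyab‖·) + N(vya‖·) + N(vyb‖·) + N(vy‖ab) ≤ N(vab‖·) + N(yab‖·) + N(va‖yb) + N(vb‖ya)`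
  on the rest implies the guarded square-free inequality `bad ≤ good` at the hub;
* **`adjForestNoSq_fibre_of_hubFour`**: hence the node's inequality `#(Fo ∩ {e,f ∈ ω}, Fo) ≤ #(Fo ∩ {e ∈ ω}, Fo ∩ {f ∈ ω})` on the split
  fibre `(M ∪ {e,f}, u₀)` whenever the pairs of `M ∪ u₀` at `o` are exactly two free pairs `oa, ob` (`o, v, y, a, b` distinct).
* **`hubFour_margin_identity`** (EVENT FORM, via the inclusion–exclusion tools of `…ForestFourTerminalSplit`): with `D = #(all four separated‖·)`,
  `E_p = #(p the only joined pair‖·)`, `M₁ = N(vy‖ab)`, `M₂ = N(va‖yb)`, `M₃ = N(vb‖ya)` ("three matchings"):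
  `bad + 2E_vy + M₂ + M₃ = good + D + 2E_ab + M₁`, i.e. (H4) ⟺ `D + 2E_ab + M₁ ≤ 2E_vy + M₂ + M₃`; the lineage's 13 positive hub states
  (fk-1 g23 §4(vi)) are exactly the pointwise obstructions of this form;
* **`adjForestNoSq_guarded_margin_of_hubFourPlus`**, **`adjForestNoSq_fibre_margin_of_hubFourPlus`**: the SHARPER 4-terminal inequality
  HUB⁺ `D + 2E_ab + M₁ ≤ M₂ + M₃` gives the node WITH MARGIN, `bad + 2E_vy ≤ good` (at a degree-3 hub `good − bad = 2E_vy` is an identity).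
Neither (H4) nor HUB⁺ is asserted here; evidence (memo §3): 0 failures on every connected rest with ≤ 8 vertices and all labelled terminal
quadruples (2,150,820 instances at degree 4), HUB⁺ included, and HUB⁺'s analogue `good − bad ≥ 2E_vy` at hub degrees 5, 6 likewise.
[cite: SempleWelsh2008, Conj. 1.1 (p. 2); Thm. 4.2 (p. 11)] [cite: CibulkaHladkyLaCroixWagner2008, Thm. 1 (p. 2)] [cite: Linusson2011, Prop. 2.6]
-/

noncomputable section

namespace Summit.CriticalPhenomena.PercolationContinuityZ3.Theorems
namespace FK

open MeasureTheory Set Literature.Probability.LatticeModels Literature.Probability.Percolation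
open scoped Classical symmDiff

variable {V : Type*} [Fintype V]

section HubFourNode

variable {M u₀ : BondConfig V} {o v y a b : V}

/-! ### The reduction: one 4-terminal inequality on the rest ⇒ the node at a degree-4 hub -/

/-- **(H4) on the rest ⇒ the guarded square-free inequality at a degree-4 hub.**  With `N(S ‖ T)` as above on `(M ∖ {oa, ob}, u₀)`:
if `N(vyab‖·) + N(vya‖·) + N(vyb‖·) + N(vy‖ab) ≤ N(vab‖·) + N(yab‖·) + N(va‖yb) + N(vb‖ya)` then `bad ≤ good` on the guarded fibre
`(M, u₀)`.  (The term `N(·‖yab)` of `good` is `N(yab‖·)` by the involution `ω ↦ ω ∆ M₂`.)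
[cite: SempleWelsh2008, Conj. 1.1 (p. 2)] [cite: CibulkaHladkyLaCroixWagner2008, Thm. 1 (p. 2)] [cite: Linusson2011, Prop. 2.6] -/
theorem adjForestNoSq_guarded_of_hubFour (hov : o ≠ v) (hoy : o ≠ y) (hoa : o ≠ a) (hob : o ≠ b) (hvy : v ≠ y) (hva : v ≠ a)
    (hvb : v ≠ b) (hya : y ≠ a) (hyb : y ≠ b) (hab : a ≠ b)
    (heM : s(o, v) ∉ M) (hfM : s(o, y) ∉ M) (heu : s(o, v) ∉ u₀) (hfu : s(o, y) ∉ u₀)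
    (hgM : s(o, a) ∈ M) (hhM : s(o, b) ∈ M) (hgu : s(o, a) ∉ u₀) (hhu : s(o, b) ∉ u₀)
    (hdeg : ∀ p ∈ M ∪ u₀, o ∈ p → p = s(o, a) ∨ p = s(o, b))
    (H4 : fibreCount (M \ {s(o, a), s(o, b)}) u₀
          (forestEv V ∩ {ω | ¬ (openGraph ω).Reachable v y ∧ ¬ (openGraph ω).Reachable v a ∧ ¬ (openGraph ω).Reachable v b ∧
            ¬ (openGraph ω).Reachable y a ∧ ¬ (openGraph ω).Reachable y b ∧ ¬ (openGraph ω).Reachable a b}) (forestEv V) +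
        fibreCount (M \ {s(o, a), s(o, b)}) u₀
          (forestEv V ∩ {ω | ¬ (openGraph ω).Reachable v y ∧ ¬ (openGraph ω).Reachable v a ∧ ¬ (openGraph ω).Reachable y a})
          (forestEv V) +
        fibreCount (M \ {s(o, a), s(o, b)}) u₀
          (forestEv V ∩ {ω | ¬ (openGraph ω).Reachable v y ∧ ¬ (openGraph ω).Reachable v b ∧ ¬ (openGraph ω).Reachable y b})
          (forestEv V) +
        fibreCount (M \ {s(o, a), s(o, b)}) u₀ (forestEv V ∩ {ω | ¬ (openGraph ω).Reachable v y})
          (forestEv V ∩ {ω | ¬ (openGraph ω).Reachable a b}) ≤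
      fibreCount (M \ {s(o, a), s(o, b)}) u₀
          (forestEv V ∩ {ω | ¬ (openGraph ω).Reachable v a ∧ ¬ (openGraph ω).Reachable v b ∧ ¬ (openGraph ω).Reachable a b})
          (forestEv V) +
        fibreCount (M \ {s(o, a), s(o, b)}) u₀
          (forestEv V ∩ {ω | ¬ (openGraph ω).Reachable y a ∧ ¬ (openGraph ω).Reachable y b ∧ ¬ (openGraph ω).Reachable a b})
          (forestEv V) +
        fibreCount (M \ {s(o, a), s(o, b)}) u₀ (forestEv V ∩ {ω | ¬ (openGraph ω).Reachable v a})
          (forestEv V ∩ {ω | ¬ (openGraph ω).Reachable y b}) +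
        fibreCount (M \ {s(o, a), s(o, b)}) u₀ (forestEv V ∩ {ω | ¬ (openGraph ω).Reachable v b})
          (forestEv V ∩ {ω | ¬ (openGraph ω).Reachable y a})) :
    fibreCount M u₀ ({ω | s(o, v) ∉ ω ∧ s(o, y) ∉ ω} ∩ {ω | insert s(o, y) (insert s(o, v) ω) ∈ forestEv V})
        ({ω | s(o, v) ∉ ω ∧ s(o, y) ∉ ω} ∩ forestEv V) ≤
      fibreCount M u₀ ({ω | s(o, v) ∉ ω ∧ s(o, y) ∉ ω} ∩ {ω | insert s(o, v) ω ∈ forestEv V})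
        ({ω | s(o, v) ∉ ω ∧ s(o, y) ∉ ω} ∩ {ω | insert s(o, y) ω ∈ forestEv V}) := by
  obtain ⟨hb, hg⟩ := hubFour_bad_good_eq hov hoy hoa hob hvy hva hvb hya hyb hab heM hfM heu hfu hgM hhM hgu hhu hdeg
  rw [hb, hg, fibreCount_swap (M \ {s(o, a), s(o, b)}) u₀ (forestEv V)
    (forestEv V ∩ {ω | ¬ (openGraph ω).Reachable y a ∧ ¬ (openGraph ω).Reachable y b ∧ ¬ (openGraph ω).Reachable a b})]
  omega

/-- **(H4) on the rest ⇒ the square-free adjacent forest Rayleigh inequality on the split fibre `(M ∪ {e,f}, u₀)` at a degree-4 hub**: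
`#(Fo ∩ {e,f ∈ ω}, Fo) ≤ #(Fo ∩ {e ∈ ω}, Fo ∩ {f ∈ ω})` whenever the pairs of `M ∪ u₀` at `o` are exactly two free pairs `oa, ob` and the
4-terminal inequality (H4) holds for `(v, y, a, b)` on `(M ∖ {oa, ob}, u₀)`.  The node at a degree-4 hub is thereby ONE inequality between
eight counts of 2-forest colourings of the `o`-deleted rest with prescribed separations among the four neighbours of `o`.
[cite: SempleWelsh2008, Conj. 1.1 (p. 2)] [cite: CibulkaHladkyLaCroixWagner2008, Thm. 1 (p. 2)] [cite: Linusson2011, Prop. 2.6] -/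
theorem adjForestNoSq_fibre_of_hubFour (hov : o ≠ v) (hoy : o ≠ y) (hoa : o ≠ a) (hob : o ≠ b) (hvy : v ≠ y) (hva : v ≠ a)
    (hvb : v ≠ b) (hya : y ≠ a) (hyb : y ≠ b) (hab : a ≠ b)
    (heM : s(o, v) ∉ M) (hfM : s(o, y) ∉ M) (heu : s(o, v) ∉ u₀) (hfu : s(o, y) ∉ u₀)
    (hgM : s(o, a) ∈ M) (hhM : s(o, b) ∈ M) (hgu : s(o, a) ∉ u₀) (hhu : s(o, b) ∉ u₀)
    (hdeg : ∀ p ∈ M ∪ u₀, o ∈ p → p = s(o, a) ∨ p = s(o, b))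
    (H4 : fibreCount (M \ {s(o, a), s(o, b)}) u₀
          (forestEv V ∩ {ω | ¬ (openGraph ω).Reachable v y ∧ ¬ (openGraph ω).Reachable v a ∧ ¬ (openGraph ω).Reachable v b ∧
            ¬ (openGraph ω).Reachable y a ∧ ¬ (openGraph ω).Reachable y b ∧ ¬ (openGraph ω).Reachable a b}) (forestEv V) +
        fibreCount (M \ {s(o, a), s(o, b)}) u₀
          (forestEv V ∩ {ω | ¬ (openGraph ω).Reachable v y ∧ ¬ (openGraph ω).Reachable v a ∧ ¬ (openGraph ω).Reachable y a})
          (forestEv V) +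
        fibreCount (M \ {s(o, a), s(o, b)}) u₀
          (forestEv V ∩ {ω | ¬ (openGraph ω).Reachable v y ∧ ¬ (openGraph ω).Reachable v b ∧ ¬ (openGraph ω).Reachable y b})
          (forestEv V) +
        fibreCount (M \ {s(o, a), s(o, b)}) u₀ (forestEv V ∩ {ω | ¬ (openGraph ω).Reachable v y})
          (forestEv V ∩ {ω | ¬ (openGraph ω).Reachable a b}) ≤
      fibreCount (M \ {s(o, a), s(o, b)}) u₀
          (forestEv V ∩ {ω | ¬ (openGraph ω).Reachable v a ∧ ¬ (openGraph ω).Reachable v b ∧ ¬ (openGraph ω).Reachable a b})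
          (forestEv V) +
        fibreCount (M \ {s(o, a), s(o, b)}) u₀
          (forestEv V ∩ {ω | ¬ (openGraph ω).Reachable y a ∧ ¬ (openGraph ω).Reachable y b ∧ ¬ (openGraph ω).Reachable a b})
          (forestEv V) +
        fibreCount (M \ {s(o, a), s(o, b)}) u₀ (forestEv V ∩ {ω | ¬ (openGraph ω).Reachable v a})
          (forestEv V ∩ {ω | ¬ (openGraph ω).Reachable y b}) +
        fibreCount (M \ {s(o, a), s(o, b)}) u₀ (forestEv V ∩ {ω | ¬ (openGraph ω).Reachable v b})
          (forestEv V ∩ {ω | ¬ (openGraph ω).Reachable y a})) :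
    fibreCount (insert s(o, y) (insert s(o, v) M)) u₀ (forestEv V ∩ {ω | s(o, v) ∈ ω ∧ s(o, y) ∈ ω}) (forestEv V) ≤
      fibreCount (insert s(o, y) (insert s(o, v) M)) u₀ (forestEv V ∩ {ω | s(o, v) ∈ ω}) (forestEv V ∩ {ω | s(o, y) ∈ ω}) :=
  adjForestNoSq_fibre_of_guarded hvy heM hfM
    (adjForestNoSq_guarded_of_hubFour hov hoy hoa hob hvy hva hvb hya hyb hab heM hfM heu hfu hgM hhM hgu hhu hdeg H4)

/-! ### The margin identity in event form and the HUB⁺ corollary -/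

/-- **THE DEGREE-4 HUB MARGIN IDENTITY (event form).**  On the rest `(M ∖ {oa,ob}, u₀)` let `D = #(all of v,y,a,b separated ‖ ·)`,
`E_p = #(p the only joined pair ‖ ·)`, `M₁ = N(vy‖ab)`, `M₂ = N(va‖yb)`, `M₃ = N(vb‖ya)` (three matchings).  Then at a degree-4 hub
`bad + 2E_vy + M₂ + M₃ = good + D + 2E_ab + M₁`, i.e. `good − bad = (M₂ + M₃ − M₁ − D − 2E_ab) + 2E_vy`
(inclusion–exclusion of `hubFour_bad_good_eq` over the cluster of the fourth terminal, plus the involution for `N(·‖yab)`).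
[cite: SempleWelsh2008, Conj. 1.1 (p. 2)] [cite: CibulkaHladkyLaCroixWagner2008, Thm. 1 (p. 2)] [cite: Linusson2011, Prop. 2.6] -/
theorem hubFour_margin_identity (hov : o ≠ v) (hoy : o ≠ y) (hoa : o ≠ a) (hob : o ≠ b) (hvy : v ≠ y) (hva : v ≠ a)
    (hvb : v ≠ b) (hya : y ≠ a) (hyb : y ≠ b) (hab : a ≠ b)
    (heM : s(o, v) ∉ M) (hfM : s(o, y) ∉ M) (heu : s(o, v) ∉ u₀) (hfu : s(o, y) ∉ u₀)
    (hgM : s(o, a) ∈ M) (hhM : s(o, b) ∈ M) (hgu : s(o, a) ∉ u₀) (hhu : s(o, b) ∉ u₀)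
    (hdeg : ∀ p ∈ M ∪ u₀, o ∈ p → p = s(o, a) ∨ p = s(o, b)) :
    fibreCount M u₀ ({ω | s(o, v) ∉ ω ∧ s(o, y) ∉ ω} ∩ {ω | insert s(o, y) (insert s(o, v) ω) ∈ forestEv V})
        ({ω | s(o, v) ∉ ω ∧ s(o, y) ∉ ω} ∩ forestEv V) +
      (2 * fibreCount (M \ {s(o, a), s(o, b)}) u₀
          (forestEv V ∩ {ω | (openGraph ω).Reachable v y ∧ ¬ (openGraph ω).Reachable v a ∧ ¬ (openGraph ω).Reachable v b ∧
            ¬ (openGraph ω).Reachable y a ∧ ¬ (openGraph ω).Reachable y b ∧ ¬ (openGraph ω).Reachable a b}) (forestEv V) +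
        fibreCount (M \ {s(o, a), s(o, b)}) u₀ (forestEv V ∩ {ω | ¬ (openGraph ω).Reachable v a}) (forestEv V ∩ {ω | ¬ (openGraph ω).Reachable y b}) +
        fibreCount (M \ {s(o, a), s(o, b)}) u₀ (forestEv V ∩ {ω | ¬ (openGraph ω).Reachable v b}) (forestEv V ∩ {ω | ¬ (openGraph ω).Reachable y a})) =
    fibreCount M u₀ ({ω | s(o, v) ∉ ω ∧ s(o, y) ∉ ω} ∩ {ω | insert s(o, v) ω ∈ forestEv V})
        ({ω | s(o, v) ∉ ω ∧ s(o, y) ∉ ω} ∩ {ω | insert s(o, y) ω ∈ forestEv V}) +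
      (fibreCount (M \ {s(o, a), s(o, b)}) u₀
          (forestEv V ∩ {ω | ¬ (openGraph ω).Reachable v y ∧ ¬ (openGraph ω).Reachable v a ∧ ¬ (openGraph ω).Reachable v b ∧
            ¬ (openGraph ω).Reachable y a ∧ ¬ (openGraph ω).Reachable y b ∧ ¬ (openGraph ω).Reachable a b}) (forestEv V) +
        2 * fibreCount (M \ {s(o, a), s(o, b)}) u₀
          (forestEv V ∩ {ω | (openGraph ω).Reachable a b ∧ ¬ (openGraph ω).Reachable v y ∧ ¬ (openGraph ω).Reachable v a ∧
            ¬ (openGraph ω).Reachable v b ∧ ¬ (openGraph ω).Reachable y a ∧ ¬ (openGraph ω).Reachable y b}) (forestEv V) +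
        fibreCount (M \ {s(o, a), s(o, b)}) u₀ (forestEv V ∩ {ω | ¬ (openGraph ω).Reachable v y}) (forestEv V ∩ {ω | ¬ (openGraph ω).Reachable a b})) := by
  obtain ⟨hb, hg⟩ := hubFour_bad_good_eq hov hoy hoa hob hvy hva hvb hya hyb hab heM hfM heu hfu hgM hhM hgu hhu hdeg
  rw [hb, hg, fibreCount_swap (M \ {s(o, a), s(o, b)}) u₀ (forestEv V)
    (forestEv V ∩ {ω | ¬ (openGraph ω).Reachable y a ∧ ¬ (openGraph ω).Reachable y b ∧ ¬ (openGraph ω).Reachable a b}),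
    fibreCount_sep_vya_split, fibreCount_sep_vyb_split, fibreCount_sep_vab_split, fibreCount_sep_yab_split]
  ring

/-- **HUB⁺ on the rest ⇒ the node at a degree-4 hub WITH MARGIN `2E_vy`** (guarded form): if `D + 2E_ab + M₁ ≤ M₂ + M₃` on
`(M ∖ {oa,ob}, u₀)` then `bad + 2E_vy ≤ good`.  HUB⁺ is conjecture-shaped (NOT asserted; 0 failures on all rests with ≤ 8 vertices);
at a degree-3 hub the analogous statement is the identity `good − bad = 2E_vy`. [cite: SempleWelsh2008, Conj. 1.1 (p. 2)] [cite: Linusson2011, Prop. 2.6] -/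
theorem adjForestNoSq_guarded_margin_of_hubFourPlus (hov : o ≠ v) (hoy : o ≠ y) (hoa : o ≠ a) (hob : o ≠ b) (hvy : v ≠ y) (hva : v ≠ a)
    (hvb : v ≠ b) (hya : y ≠ a) (hyb : y ≠ b) (hab : a ≠ b)
    (heM : s(o, v) ∉ M) (hfM : s(o, y) ∉ M) (heu : s(o, v) ∉ u₀) (hfu : s(o, y) ∉ u₀)
    (hgM : s(o, a) ∈ M) (hhM : s(o, b) ∈ M) (hgu : s(o, a) ∉ u₀) (hhu : s(o, b) ∉ u₀)
    (hdeg : ∀ p ∈ M ∪ u₀, o ∈ p → p = s(o, a) ∨ p = s(o, b))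
    (HUBplus : fibreCount (M \ {s(o, a), s(o, b)}) u₀
          (forestEv V ∩ {ω | ¬ (openGraph ω).Reachable v y ∧ ¬ (openGraph ω).Reachable v a ∧ ¬ (openGraph ω).Reachable v b ∧
            ¬ (openGraph ω).Reachable y a ∧ ¬ (openGraph ω).Reachable y b ∧ ¬ (openGraph ω).Reachable a b}) (forestEv V) +
        2 * fibreCount (M \ {s(o, a), s(o, b)}) u₀
          (forestEv V ∩ {ω | (openGraph ω).Reachable a b ∧ ¬ (openGraph ω).Reachable v y ∧ ¬ (openGraph ω).Reachable v a ∧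
            ¬ (openGraph ω).Reachable v b ∧ ¬ (openGraph ω).Reachable y a ∧ ¬ (openGraph ω).Reachable y b}) (forestEv V) +
        fibreCount (M \ {s(o, a), s(o, b)}) u₀ (forestEv V ∩ {ω | ¬ (openGraph ω).Reachable v y}) (forestEv V ∩ {ω | ¬ (openGraph ω).Reachable a b}) ≤
      fibreCount (M \ {s(o, a), s(o, b)}) u₀ (forestEv V ∩ {ω | ¬ (openGraph ω).Reachable v a}) (forestEv V ∩ {ω | ¬ (openGraph ω).Reachable y b}) +
        fibreCount (M \ {s(o, a), s(o, b)}) u₀ (forestEv V ∩ {ω | ¬ (openGraph ω).Reachable v b}) (forestEv V ∩ {ω | ¬ (openGraph ω).Reachable y a})) :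
    fibreCount M u₀ ({ω | s(o, v) ∉ ω ∧ s(o, y) ∉ ω} ∩ {ω | insert s(o, y) (insert s(o, v) ω) ∈ forestEv V})
        ({ω | s(o, v) ∉ ω ∧ s(o, y) ∉ ω} ∩ forestEv V) +
      2 * fibreCount (M \ {s(o, a), s(o, b)}) u₀
          (forestEv V ∩ {ω | (openGraph ω).Reachable v y ∧ ¬ (openGraph ω).Reachable v a ∧ ¬ (openGraph ω).Reachable v b ∧
            ¬ (openGraph ω).Reachable y a ∧ ¬ (openGraph ω).Reachable y b ∧ ¬ (openGraph ω).Reachable a b}) (forestEv V) ≤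
    fibreCount M u₀ ({ω | s(o, v) ∉ ω ∧ s(o, y) ∉ ω} ∩ {ω | insert s(o, v) ω ∈ forestEv V})
        ({ω | s(o, v) ∉ ω ∧ s(o, y) ∉ ω} ∩ {ω | insert s(o, y) ω ∈ forestEv V}) := by
  have key := hubFour_margin_identity hov hoy hoa hob hvy hva hvb hya hyb hab heM hfM heu hfu hgM hhM hgu hhu hdeg
  omega

/-- **HUB⁺ on the rest ⇒ the square-free adjacent forest Rayleigh inequality on the split fibre `(M ∪ {e,f}, u₀)` with margin**:
`#(Fo ∩ {e,f ∈ ω}, Fo) + 2E_vy ≤ #(Fo ∩ {e ∈ ω}, Fo ∩ {f ∈ ω})` at a degree-4 hub. [cite: SempleWelsh2008, Conj. 1.1 (p. 2)] [cite: Linusson2011, Prop. 2.6] -/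
theorem adjForestNoSq_fibre_margin_of_hubFourPlus (hov : o ≠ v) (hoy : o ≠ y) (hoa : o ≠ a) (hob : o ≠ b) (hvy : v ≠ y) (hva : v ≠ a)
    (hvb : v ≠ b) (hya : y ≠ a) (hyb : y ≠ b) (hab : a ≠ b)
    (heM : s(o, v) ∉ M) (hfM : s(o, y) ∉ M) (heu : s(o, v) ∉ u₀) (hfu : s(o, y) ∉ u₀)
    (hgM : s(o, a) ∈ M) (hhM : s(o, b) ∈ M) (hgu : s(o, a) ∉ u₀) (hhu : s(o, b) ∉ u₀)
    (hdeg : ∀ p ∈ M ∪ u₀, o ∈ p → p = s(o, a) ∨ p = s(o, b))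
    (HUBplus : fibreCount (M \ {s(o, a), s(o, b)}) u₀
          (forestEv V ∩ {ω | ¬ (openGraph ω).Reachable v y ∧ ¬ (openGraph ω).Reachable v a ∧ ¬ (openGraph ω).Reachable v b ∧
            ¬ (openGraph ω).Reachable y a ∧ ¬ (openGraph ω).Reachable y b ∧ ¬ (openGraph ω).Reachable a b}) (forestEv V) +
        2 * fibreCount (M \ {s(o, a), s(o, b)}) u₀
          (forestEv V ∩ {ω | (openGraph ω).Reachable a b ∧ ¬ (openGraph ω).Reachable v y ∧ ¬ (openGraph ω).Reachable v a ∧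
            ¬ (openGraph ω).Reachable v b ∧ ¬ (openGraph ω).Reachable y a ∧ ¬ (openGraph ω).Reachable y b}) (forestEv V) +
        fibreCount (M \ {s(o, a), s(o, b)}) u₀ (forestEv V ∩ {ω | ¬ (openGraph ω).Reachable v y}) (forestEv V ∩ {ω | ¬ (openGraph ω).Reachable a b}) ≤
      fibreCount (M \ {s(o, a), s(o, b)}) u₀ (forestEv V ∩ {ω | ¬ (openGraph ω).Reachable v a}) (forestEv V ∩ {ω | ¬ (openGraph ω).Reachable y b}) +
        fibreCount (M \ {s(o, a), s(o, b)}) u₀ (forestEv V ∩ {ω | ¬ (openGraph ω).Reachable v b}) (forestEv V ∩ {ω | ¬ (openGraph ω).Reachable y a})) :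
    fibreCount (insert s(o, y) (insert s(o, v) M)) u₀ (forestEv V ∩ {ω | s(o, v) ∈ ω ∧ s(o, y) ∈ ω}) (forestEv V) +
      2 * fibreCount (M \ {s(o, a), s(o, b)}) u₀
          (forestEv V ∩ {ω | (openGraph ω).Reachable v y ∧ ¬ (openGraph ω).Reachable v a ∧ ¬ (openGraph ω).Reachable v b ∧
            ¬ (openGraph ω).Reachable y a ∧ ¬ (openGraph ω).Reachable y b ∧ ¬ (openGraph ω).Reachable a b}) (forestEv V) ≤
    fibreCount (insert s(o, y) (insert s(o, v) M)) u₀ (forestEv V ∩ {ω | s(o, v) ∈ ω}) (forestEv V ∩ {ω | s(o, y) ∈ ω}) := by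
  have hef : s(o, v) ≠ s(o, y) := fun h' => hvy (Sym2.congr_right.1 h')
  rw [fibreCount_insert_two_both heM hfM, fibreCount_insert_two_one hef heM hfM]
  exact adjForestNoSq_guarded_margin_of_hubFourPlus hov hoy hoa hob hvy hva hvb hya hyb hab heM hfM heu hfu hgM hhM hgu hhu hdeg HUBplus

end HubFourNode

end FK
end Summit.CriticalPhenomena.PercolationContinuityZ3.Theorems

end
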